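import Literature.NumberTheory.LocalFields.KrasnerLocallyConstant
import Mathlib.NumberTheory.Padics.Complex
import Mathlib.NumberTheory.Padics.RingHoms
import HarnessLib

/-!
# R90-TF · S3 · THEOREMS — `R90S3PlantingRadii` ((U3-F) assembly, layer B3): the RADII BOOKKEEPING of the planting —
# root separation of the `p`-adic target in `Q̄_p`, ONE precision `N` with `p^{-N}` below every radius, and «congruent mod `p^N` ⇒ coefficients
# `p^{-N}`-close in `Q̄_p`», packaged as exactly the hypothesis block of ★ `KrasnerLocallyConstant`

R90-TF section S3 (dealer R90-C12-plan (g2), by name 2026-09-05T01:17:07Z «B3 `Theorems/R90S3PlantingRadii.lean`»); crux H413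
(`stmt-HodgeConjecture-24833`, lane `--supports … --as helper`), route `HCCMUnconditional`; captain K2E3-p17 (g11)'s skeleton
`R90/S3/SKELETON-P8-AuxGlobaliseField.K2E3-p17-g11.md` 941dd0e5, step B3 «RADII: `δ` := min root separation of `H` in `Q̄_p`, the ★ P2″ transport radius,
precision `N` with `p^{−N} < min(δ^d, …)`»; seat K2E3-p36 (g3).  Stated over an ABSTRACT monic `H : ℤ_[p][X]` (B2's `h₀·∏(X − cᵢ)` and B4's planted `g` are
instantiated by their owners; B6 = K2E4-p14 consumes the block below through ★ `KrasnerLocallyConstant` :145∕:159∕:246∕:261∕:303).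

WHAT IS PROVED (Mathlib-only + ★ `KrasnerLocallyConstant`; theorems only — no `def`, no instance, no notation, no `sorry`):
* §1 `exists_roots_separation` — the roots of ANY polynomial over a normed field are pairwise `≥ δ` apart for some `0 < δ ≤ 1` (minimum over the
  finite set of distances of distinct roots);
* §2 `exists_pow_inv_lt`, `pow_inv_le_pow_inv_of_le`, `exists_pow_inv_lt_three` — ONE exponent `N` with `(p^N)⁻¹` below three given positive radii
  (Mathlib `exists_pow_lt_of_lt_one`; `(p^N)⁻¹` is antitone in `N`);
* §3 `norm_algebraMap_sub_le_of_toZModPow_eq`, `norm_coeff_sub_le_of_map_toZModPow_eq` — «`a ≡ b (mod p^N)` in `ℤ_p` ⇒ `‖a − b‖ ≤ (p^N)⁻¹` in any normed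
  `ℚ_p`-algebra `K`» (Mathlib `PadicInt.ker_toZModPow`, `PadicInt.norm_le_pow_iff_mem_span_pow`, `norm_algebraMap'`), coefficientwise for `H ≡ G (mod p^N)`;
  `norm_coeff_map_le_one` — the coefficients of `H ∈ ℤ_p[X]` have norm `≤ 1` in `K`;
* §4 **`exists_krasnerPrecision`** — for `H ∈ ℤ_p[X]` monic of degree `n ≥ 1` and two external radii `r₁, r₂ > 0` (the ★ P2″ transport radius and the
  square-class radius in the consumer): `∃ δ N`, `0 < δ ≤ 1`, the roots of `H` in `Q̄_p = PadicAlgCl p` are pairwise `≥ δ` apart and lie in the closed unit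
  ball (★ `norm_root_le_one`), `(p^N)⁻¹ < δ ^ n`, `(p^N)⁻¹ < r₁`, `(p^N)⁻¹ < r₂`, and EVERY `G ∈ ℤ_p[X]` with `G ≡ H (mod p^N)` has `Q̄_p`-coefficients within
  `(p^N)⁻¹` of those of `H` — i.e. the data `(hδ, hsep, hε := le_of_lt …, hεδ, hcoeff, hFr)` of ★ `exists_root_near_of_coeff_near′` ∕ `nodup_roots_of_coeff_near` ∕
  `le_norm_sub_of_coeff_near` ∕ `adjoin_eq_adjoin_of_coeff_near` at `ε := (p^N)⁻¹`.

HONEST LABEL: HC_CM is proved only modulo the 7 printed citations (2 remaining named inputs: hLiu418 = stmt-HodgeConjecture-24832, h413 =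
stmt-HodgeConjecture-24833) until rung 0 closes; elementary metric bookkeeping for a sub-step of the GENUINE residual (U3-F); proves nothing printed;
count-neutral.  REL ≠ ★ ≠ BUILT.

## References
* [Gouvea1993PadicNumbers] F. Q. Gouvêa, *p-adic Numbers*, Universitext (1993), §6.8, Cor. 6.8.3 (continuity of roots, Krasner).
* [NeukirchANT1999] J. Neukirch, *Algebraic Number Theory* (1999), Ch. II (8.2)–(8.4).
-/

set_option autoImplicit false
-- the mandated namespace repeats the single-problem summit's segment (`HodgeConjecture.HodgeConjecture`)
set_option linter.dupNamespace false

noncomputable section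

namespace Summit.HodgeConjecture.HodgeConjecture.R90.S3

open Polynomial

/-! ## §1 Root separation -/

/-- **Distinct roots are uniformly separated**: for any polynomial `F` over a normed field there is `0 < δ ≤ 1` with `δ ≤ ‖a − a′‖` for all distinct
roots `a ≠ a′` of `F` (the set of roots is finite; take the least distance, capped at `1`).  This is the `hsep` datum of ★ `KrasnerLocallyConstant`.
[cite: Gouvea1993PadicNumbers, Cor 6.8.3] -/
theorem exists_roots_separation {L : Type*} [NormedField L] (F : L[X]) :
    ∃ δ : ℝ, 0 < δ ∧ δ ≤ 1 ∧ ∀ a ∈ F.roots, ∀ a' ∈ F.roots, a ≠ a' → δ ≤ ‖a - a'‖ := by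
  classical
  -- the finite set of distances between distinct roots
  set S : Finset ℝ := ((F.roots.toFinset ×ˢ F.roots.toFinset).filter fun q => q.1 ≠ q.2).image fun q => ‖q.1 - q.2‖ with hS
  have hmem : ∀ a ∈ F.roots, ∀ a' ∈ F.roots, a ≠ a' → ‖a - a'‖ ∈ S := by
    intro a ha a' ha' hne
    refine Finset.mem_image.2 ⟨(a, a'), Finset.mem_filter.2 ⟨Finset.mem_product.2 ⟨?_, ?_⟩, hne⟩, rfl⟩
    · exact Multiset.mem_toFinset.2 ha
    · exact Multiset.mem_toFinset.2 ha'
  have hpos : ∀ r ∈ S, 0 < r := by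
    intro r hr
    obtain ⟨q, hq, rfl⟩ := Finset.mem_image.1 hr
    exact norm_pos_iff.2 (sub_ne_zero.2 (Finset.mem_filter.1 hq).2)
  by_cases hne : S.Nonempty
  · refine ⟨min 1 (S.min' hne), lt_min one_pos (hpos _ (S.min'_mem hne)), min_le_left _ _, fun a ha a' ha' h => ?_⟩
    exact (min_le_right _ _).trans (S.min'_le _ (hmem a ha a' ha' h))
  · refine ⟨1, one_pos, le_rfl, fun a ha a' ha' h => ?_⟩
    exact absurd ⟨_, hmem a ha a' ha' h⟩ hne

/-! ## §2 One precision below finitely many radii -/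

/-- `(p^N)⁻¹ < r` for some `N`, for every `p > 1` and `r > 0` (Mathlib `exists_pow_lt_of_lt_one`). [cite: Gouvea1993PadicNumbers, Cor 6.8.3] -/
theorem exists_pow_inv_lt {p : ℕ} (hp : 1 < p) {r : ℝ} (hr : 0 < r) : ∃ N : ℕ, ((p : ℝ) ^ N)⁻¹ < r := by
  have hp1 : (1 : ℝ) < p := by exact_mod_cast hp
  obtain ⟨N, hN⟩ := exists_pow_lt_of_lt_one hr (inv_lt_one_of_one_lt₀ hp1)
  exact ⟨N, by rwa [← inv_pow]⟩

/-- `(p^N)⁻¹` is antitone in `N` (for `p ≥ 1`). [cite: Gouvea1993PadicNumbers, Cor 6.8.3] -/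
theorem pow_inv_le_pow_inv_of_le {p : ℕ} (hp : 1 ≤ p) {M N : ℕ} (h : M ≤ N) : ((p : ℝ) ^ N)⁻¹ ≤ ((p : ℝ) ^ M)⁻¹ := by
  have hp1 : (1 : ℝ) ≤ p := by exact_mod_cast hp
  have hpos : (0 : ℝ) < (p : ℝ) ^ M := pow_pos (lt_of_lt_of_le one_pos hp1) M
  exact inv_anti₀ hpos (pow_le_pow_right₀ hp1 h)

/-- **ONE precision below three radii**: for `p > 1` and `r₁, r₂, r₃ > 0` there is `N` with `(p^N)⁻¹ < r₁`, `(p^N)⁻¹ < r₂`, `(p^N)⁻¹ < r₃` (the planting uses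
`r₁ := δ ^ n` (root separation), `r₂ :=` the ★ P2″ transport radius, `r₃ :=` the square-class radius). [cite: Gouvea1993PadicNumbers, Cor 6.8.3] -/
theorem exists_pow_inv_lt_three {p : ℕ} (hp : 1 < p) {r₁ r₂ r₃ : ℝ} (h₁ : 0 < r₁) (h₂ : 0 < r₂) (h₃ : 0 < r₃) :
    ∃ N : ℕ, ((p : ℝ) ^ N)⁻¹ < r₁ ∧ ((p : ℝ) ^ N)⁻¹ < r₂ ∧ ((p : ℝ) ^ N)⁻¹ < r₃ := by
  obtain ⟨N₁, hN₁⟩ := exists_pow_inv_lt hp h₁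
  obtain ⟨N₂, hN₂⟩ := exists_pow_inv_lt hp h₂
  obtain ⟨N₃, hN₃⟩ := exists_pow_inv_lt hp h₃
  refine ⟨N₁ + N₂ + N₃, ?_, ?_, ?_⟩
  · exact (pow_inv_le_pow_inv_of_le hp.le (by omega)).trans_lt hN₁
  · exact (pow_inv_le_pow_inv_of_le hp.le (by omega)).trans_lt hN₂
  · exact (pow_inv_le_pow_inv_of_le hp.le (by omega)).trans_lt hN₃

/-! ## §3 Congruence mod `p^N` in `ℤ_p` ⇒ closeness in a normed `ℚ_p`-algebra -/

section Padic

variable {p : ℕ} [Fact p.Prime] {K : Type*} [NormedField K] [NormedAlgebra ℚ_[p] K]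

/-- The composite `ℤ_p → ℚ_p → K` is norm preserving (`K` a normed `ℚ_p`-algebra). [cite: Gouvea1993PadicNumbers, Cor 6.8.3] -/
theorem norm_algebraMap_padicInt (a : ℤ_[p]) : ‖algebraMap ℚ_[p] K (algebraMap ℤ_[p] ℚ_[p] a)‖ = ‖a‖ := by
  rw [norm_algebraMap']
  exact PadicInt.padic_norm_e_of_padicInt a

/-- **`a ≡ b (mod p^N)` ⇒ `‖a − b‖ ≤ (p^N)⁻¹` in `K`** (Mathlib `PadicInt.ker_toZModPow`, `PadicInt.norm_le_pow_iff_mem_span_pow`).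
[cite: Gouvea1993PadicNumbers, Cor 6.8.3] -/
theorem norm_algebraMap_sub_le_of_toZModPow_eq (N : ℕ) {a b : ℤ_[p]} (h : PadicInt.toZModPow N a = PadicInt.toZModPow N b) :
    ‖algebraMap ℚ_[p] K (algebraMap ℤ_[p] ℚ_[p] a) - algebraMap ℚ_[p] K (algebraMap ℤ_[p] ℚ_[p] b)‖ ≤ ((p : ℝ) ^ N)⁻¹ := by
  have hker : a - b ∈ RingHom.ker (PadicInt.toZModPow N) := by
    rw [RingHom.mem_ker, map_sub, h, sub_self]
  rw [PadicInt.ker_toZModPow] at hker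
  have hnorm : ‖a - b‖ ≤ (p : ℝ) ^ (-(N : ℤ)) := (PadicInt.norm_le_pow_iff_mem_span_pow _ _).2 hker
  rw [zpow_neg, zpow_natCast] at hnorm
  rw [← map_sub, ← map_sub, norm_algebraMap_padicInt]
  exact hnorm

/-- **`H ≡ G (mod p^N)` coefficientwise ⇒ the `K`-coefficients of `H` and `G` are within `(p^N)⁻¹`** — the `hcoeff` datum of ★ `KrasnerLocallyConstant` at
`ε := (p^N)⁻¹`. [cite: Gouvea1993PadicNumbers, Cor 6.8.3] -/
theorem norm_coeff_sub_le_of_map_toZModPow_eq (N : ℕ) {H G : ℤ_[p][X]}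
    (h : H.map (PadicInt.toZModPow N) = G.map (PadicInt.toZModPow N)) (i : ℕ) :
    ‖((H.map (algebraMap ℤ_[p] ℚ_[p])).map (algebraMap ℚ_[p] K)).coeff i -
        ((G.map (algebraMap ℤ_[p] ℚ_[p])).map (algebraMap ℚ_[p] K)).coeff i‖ ≤ ((p : ℝ) ^ N)⁻¹ := by
  have hi : PadicInt.toZModPow N (H.coeff i) = PadicInt.toZModPow N (G.coeff i) := by
    have := congrArg (fun P : (ZMod (p ^ N))[X] => P.coeff i) h
    simpa only [coeff_map] using this
  simpa only [coeff_map] using norm_algebraMap_sub_le_of_toZModPow_eq (K := K) N hi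

/-- The `K`-coefficients of a polynomial with `ℤ_p`-coefficients lie in the closed unit ball. [cite: Gouvea1993PadicNumbers, Cor 6.8.3] -/
theorem norm_coeff_map_le_one (H : ℤ_[p][X]) (i : ℕ) :
    ‖((H.map (algebraMap ℤ_[p] ℚ_[p])).map (algebraMap ℚ_[p] K)).coeff i‖ ≤ 1 := by
  rw [coeff_map, coeff_map, norm_algebraMap_padicInt]
  exact PadicInt.norm_le_one _

end Padic

/-! ## §4 The Krasner precision of a `p`-adic target -/

/-- **THE KRASNER PRECISION (B3).**  Let `H ∈ ℤ_p[X]` be monic of degree `n ≥ 1` and let `r₁, r₂ > 0` be two further radii.  Then there are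
`0 < δ ≤ 1` and `N : ℕ` such that: the roots of `H` in `Q̄_p = PadicAlgCl p` are pairwise at distance `≥ δ` and lie in the closed unit ball;
`(p^N)⁻¹ < δ ^ n`, `(p^N)⁻¹ < r₁`, `(p^N)⁻¹ < r₂`; and every `G ∈ ℤ_p[X]` congruent to `H` modulo `p^N` (coefficientwise, `G.map (toZModPow N) =
H.map (toZModPow N)`) has `Q̄_p`-coefficients within `(p^N)⁻¹` of those of `H`.  With `ε := (p^N)⁻¹` this is the complete hypothesis block
`(hδ, hsep, hε, hεδ, hcoeff, hFr)` of ★ `KrasnerLocallyConstant.exists_root_near_of_coeff_near′` ∕ `nodup_roots_of_coeff_near` ∕ `le_norm_sub_of_coeff_near` ∕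
`adjoin_eq_adjoin_of_coeff_near` (the roots of such a `G` lie in the unit ball too, by ★ `norm_root_le_one` and `norm_coeff_map_le_one`).
[cite: Gouvea1993PadicNumbers, Cor 6.8.3] [cite: NeukirchANT1999, Ch. II (8.2)-(8.4)] -/
theorem exists_krasnerPrecision {p : ℕ} [Fact p.Prime] (H : ℤ_[p][X]) (hm : H.Monic) {r₁ r₂ : ℝ} (h₁ : 0 < r₁) (h₂ : 0 < r₂) :
    ∃ (δ : ℝ) (N : ℕ), 0 < δ ∧ δ ≤ 1 ∧
      (∀ a ∈ ((H.map (algebraMap ℤ_[p] ℚ_[p])).map (algebraMap ℚ_[p] (PadicAlgCl p))).roots,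
        ∀ a' ∈ ((H.map (algebraMap ℤ_[p] ℚ_[p])).map (algebraMap ℚ_[p] (PadicAlgCl p))).roots, a ≠ a' → δ ≤ ‖a - a'‖) ∧
      (∀ a ∈ ((H.map (algebraMap ℤ_[p] ℚ_[p])).map (algebraMap ℚ_[p] (PadicAlgCl p))).roots, ‖a‖ ≤ 1) ∧
      ((p : ℝ) ^ N)⁻¹ < δ ^ H.natDegree ∧ ((p : ℝ) ^ N)⁻¹ < r₁ ∧ ((p : ℝ) ^ N)⁻¹ < r₂ ∧
      ∀ G : ℤ_[p][X], G.map (PadicInt.toZModPow N) = H.map (PadicInt.toZModPow N) →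
        ∀ i, ‖((H.map (algebraMap ℤ_[p] ℚ_[p])).map (algebraMap ℚ_[p] (PadicAlgCl p))).coeff i -
          ((G.map (algebraMap ℤ_[p] ℚ_[p])).map (algebraMap ℚ_[p] (PadicAlgCl p))).coeff i‖ ≤ ((p : ℝ) ^ N)⁻¹ := by
  obtain ⟨δ, hδ, hδ1, hsep⟩ := exists_roots_separation ((H.map (algebraMap ℤ_[p] ℚ_[p])).map (algebraMap ℚ_[p] (PadicAlgCl p)))
  obtain ⟨N, hN₀, hN₁, hN₂⟩ := exists_pow_inv_lt_three (Fact.out : p.Prime).one_lt (pow_pos hδ H.natDegree) h₁ h₂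
  have hmK : ((H.map (algebraMap ℤ_[p] ℚ_[p])).map (algebraMap ℚ_[p] (PadicAlgCl p))).Monic := (hm.map _).map _
  refine ⟨δ, N, hδ, hδ1, hsep, fun a ha => ?_, hN₀, hN₁, hN₂, fun G hG i => ?_⟩
  · exact Literature.NumberTheory.LocalFields.norm_root_le_one hmK (norm_coeff_map_le_one H) ((mem_roots hmK.ne_zero).1 ha)
  · exact norm_coeff_sub_le_of_map_toZModPow_eq N hG.symm i

end Summit.HodgeConjecture.HodgeConjecture.R90.S3

end
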